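import HarnessLib

/-!
# A floating-point simplex for certificate SEARCH (`QuadCert`, part 4)

Topic `Literature/Analysis/ValidatedNumerics`.  An UNTRUSTED numerical tool used by certificate generators that run inside
`native_decide` (the produced certificates are re-checked exactly by `QuadCertTree.Step.ok`; nothing here is used in any
soundness argument): a dense tableau simplex over `Float` for

  `maximize c·x subject to A x ≤ b, x ∈ ℝⁿ free`,

returning a status, a primal point and NONNEGATIVE DUAL MULTIPLIERS `y` (`Aᵀy = c`, `b·y = c·x` at optimality), and a
phase-one / Farkas routine `LP.farkas` returning `s` and `y ≥ 0` with `Aᵀ y = 0`, `b·y = −s` (`s > 0` iff infeasible).  Free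
variables are split `x = x⁺ − x⁻`; an origin shift makes all right-hand sides nonnegative so no artificial variables are needed;
Dantzig's rule with Bland's rule as the anti-cycling fallback [folklore].  Correctness is irrelevant for soundness and is not
proved; the reference implementation is the Python twin `gen/lp.py` of the shell-certificate generator (validated on random LPs).
-/

namespace Literature.Analysis.ValidatedNumerics

namespace QuadCert

namespace LP

/-- Dense row-major `Float` matrix with `rows × cols` entries. [folklore] -/
structure FMat where
  /-- number of rows -/
  rows : Nat
  /-- number of columns -/
  cols : Nat
  /-- entries, row-major -/
  data : FloatArray
  deriving Inhabited

namespace FMat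

/-- Zero matrix. [folklore] -/
def zeros (r c : Nat) : FMat := ⟨r, c, ⟨Array.replicate (r * c) 0.0⟩⟩

/-- Entry. [folklore] -/
@[inline] def get (M : FMat) (i j : Nat) : Float := M.data.get! (i * M.cols + j)

/-- Set an entry. [folklore] -/
@[inline] def set (M : FMat) (i j : Nat) (v : Float) : FMat := { M with data := M.data.set! (i * M.cols + j) v }

end FMat

/-- Result of `solveStd` / `solve`. [folklore] -/
inductive Status where
  | opt | unbounded | infeasible | fail
  deriving DecidableEq, Repr, Inhabited

/-- Tableau state: `m` constraint rows over `N` structural+slack columns plus the rhs column (index `N`); `basis[i]` is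
the basic column of row `i`. [folklore] -/
structure Tab where
  /-- the tableau (m × (N+1)) -/
  T : FMat
  /-- basic column per row -/
  basis : Array Nat
  deriving Inhabited

/-- Pivot on `(r, col)`. [folklore] -/
def pivot (tb : Tab) (r col : Nat) : Tab := Id.run do
  let m := tb.T.rows
  let W := tb.T.cols
  let mut T := tb.T
  let piv := T.get r col
  for j in [0:W] do
    T := T.set r j (T.get r j / piv)
  for i in [0:m] do
    if i != r then
      let f := T.get i col
      if f != 0.0 then
        for j in [0:W] do
          T := T.set i j (T.get i j - f * T.get r j)
  return { T := T, basis := tb.basis.set! r col }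

/-- Run the simplex for `maximize obj` over the current tableau (columns `< nAllowed` may enter); at most `fuel` pivots.
Returns the final tableau and `some true` (optimal) / `some false` (unbounded) / `none` (fuel exhausted). [folklore] -/
def iterate (obj : FloatArray) (nAllowed : Nat) : Nat → Nat → Tab → Tab × Option Bool
  | 0, _, tb => (tb, none)
  | fuel + 1, it, tb => Id.run do
    let m := tb.T.rows
    let N := tb.T.cols - 1
    let tol : Float := 1e-9
    -- reduced costs
    let mut inBasis : Array Bool := Array.replicate (N + 1) false
    for i in [0:m] do
      inBasis := inBasis.set! (tb.basis[i]!) true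
    let bland := it > 400
    let mut best : Option Nat := none
    let mut bestrc : Float := tol
    for j in [0:nAllowed] do
      if best.isSome && bland then
        pure ()
      else if !(inBasis[j]!) then
        let mut rc := obj.get! j
        for i in [0:m] do
          let cb := obj.get! (tb.basis[i]!)
          if cb != 0.0 then rc := rc - cb * tb.T.get i j
        if rc > tol then
          if bland then
            best := some j
          else if rc > bestrc then
            bestrc := rc; best := some j
    match best with
    | none => return (tb, some true)
    | some col =>
      -- ratio test (Bland tie-break on the basic column index)
      let mut rarg : Option Nat := none
      let mut rmin : Float := 0.0
      for i in [0:m] do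
        let a := tb.T.get i col
        if a > tol then
          let ratio := tb.T.get i N / a
          match rarg with
          | none => rarg := some i; rmin := ratio
          | some i0 =>
            if ratio < rmin - 1e-12 || (Float.abs (ratio - rmin) <= 1e-12 && tb.basis[i]! < tb.basis[i0]!) then
              rarg := some i; rmin := ratio
      match rarg with
      | none => return (tb, some false)
      | some r => return iterate obj nAllowed fuel (it + 1) (pivot tb r col)

/-- Standard form with NONNEGATIVE right-hand side: `maximize c·x`, `A x ≤ b` (`b ≥ 0`), `x ≥ 0`.
Returns `(status, x, y)`; `y` are the duals of the rows. [folklore] -/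
def solveStd (c : FloatArray) (A : FMat) (b : FloatArray) (fuel : Nat := 20000) :
    Status × FloatArray × FloatArray := Id.run do
  let m := A.rows
  let n := A.cols
  let N := n + m
  -- tableau [A | I | b]
  let mut T := FMat.zeros m (N + 1)
  for i in [0:m] do
    for j in [0:n] do
      T := T.set i j (A.get i j)
    T := T.set i (n + i) 1.0
    T := T.set i N (if b.get! i < 0.0 then 0.0 else b.get! i)
  let basis : Array Nat := (Array.range m).map (· + n)
  let obj : FloatArray := ⟨(Array.range (N + 1)).map fun j => if j < n then c.get! j else 0.0⟩
  let (tb, st) := iterate obj N fuel 0 ⟨T, basis⟩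
  match st with
  | none => return (.fail, ⟨#[]⟩, ⟨#[]⟩)
  | some false => return (.unbounded, ⟨#[]⟩, ⟨#[]⟩)
  | some true =>
    let mut x : FloatArray := ⟨Array.replicate n 0.0⟩
    for i in [0:m] do
      let bi := tb.basis[i]!
      if bi < n then x := x.set! bi (tb.T.get i N)
    -- duals: y_i = reduced cost of slack i = sum_r cb_r T[r][n+i]
    let mut y : FloatArray := ⟨Array.replicate m 0.0⟩
    for i in [0:m] do
      let mut s : Float := 0.0
      for r in [0:m] do
        let cb := obj.get! (tb.basis[r]!)
        if cb != 0.0 then s := s + cb * tb.T.get r (n + i)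
      y := y.set! i s
    return (.opt, x, y)

/-- FREE variables, nonnegative rhs: `maximize c·x`, `A x ≤ b` (`b ≥ 0`), via the split `x = x⁺ − x⁻`. [folklore] -/
def solveFreeNonneg (c : FloatArray) (A : FMat) (b : FloatArray) : Status × FloatArray × FloatArray := Id.run do
  let m := A.rows
  let n := A.cols
  let mut A2 := FMat.zeros m (2 * n)
  for i in [0:m] do
    for j in [0:n] do
      A2 := A2.set i j (A.get i j)
      A2 := A2.set i (n + j) (0.0 - A.get i j)
  let c2 : FloatArray := ⟨(Array.range (2 * n)).map fun j => if j < n then c.get! j else 0.0 - c.get! (j - n)⟩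
  let (st, x2, y) := solveStd c2 A2 b
  match st with
  | .opt =>
    let x : FloatArray := ⟨(Array.range n).map fun j => x2.get! j - x2.get! (n + j)⟩
    return (.opt, x, y)
  | s => return (s, ⟨#[]⟩, ⟨#[]⟩)

/-- Minimum of a `FloatArray` (0 if empty). [folklore] -/
def fmin (b : FloatArray) : Float := Id.run do
  let mut r : Float := if b.size == 0 then 0.0 else b.get! 0
  for i in [0:b.size] do
    if b.get! i < r then r := b.get! i
  return r

/-- **Farkas / phase one**: `minimize s` subject to `A x − s ≤ b`, `0 ≤ s ≤ S₀`.  Returns `(s, y, x)` with `y ≥ 0` the duals of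
the rows of `A`; the system `A x ≤ b` is infeasible iff `s > 0` (then `Aᵀy = 0`, `b·y = −s < 0`, `Σ y = 1`). [folklore] -/
def farkas (A : FMat) (b : FloatArray) : Option (Float × FloatArray × FloatArray) := Id.run do
  let m := A.rows
  let n := A.cols
  if m == 0 then return some (0.0, ⟨#[]⟩, ⟨Array.replicate n 0.0⟩)
  let bmin := fmin b
  let s0 : Float := if bmin < 0.0 then 0.0 - bmin else 0.0
  let S0 : Float := if s0 + 1.0 > 1.0 then s0 + 1.0 else 1.0
  -- variables (x, t), s = s0 + t : rows  A x − t ≤ b + s0 ; −t ≤ s0 ; t ≤ S0 − s0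
  let mut A2 := FMat.zeros (m + 2) (n + 1)
  for i in [0:m] do
    for j in [0:n] do
      A2 := A2.set i j (A.get i j)
    A2 := A2.set i n (0.0 - 1.0)
  A2 := A2.set m n (0.0 - 1.0)
  A2 := A2.set (m + 1) n 1.0
  let b2 : FloatArray := ⟨((Array.range m).map fun i => b.get! i + s0) ++ #[s0, S0 - s0]⟩
  let c2 : FloatArray := ⟨(Array.range (n + 1)).map fun j => if j < n then 0.0 else 0.0 - 1.0⟩
  let (st, x, y) := solveFreeNonneg c2 A2 b2
  match st with
  | .opt =>
    let yA : FloatArray := ⟨(Array.range m).map fun i => y.get! i⟩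
    let xA : FloatArray := ⟨(Array.range n).map fun j => x.get! j⟩
    return some (s0 + x.get! n, yA, xA)
  | _ => return none

/-- **The solver**: `maximize c·x` subject to `A x ≤ b`, `x` free.  `(status, x, y)` with duals `y ≥ 0`. [folklore] -/
def solve (c : FloatArray) (A : FMat) (b : FloatArray) : Status × FloatArray × FloatArray := Id.run do
  let m := A.rows
  let n := A.cols
  if m == 0 then return (.unbounded, ⟨#[]⟩, ⟨#[]⟩)
  if fmin b < 0.0 then
    match farkas A b with
    | none => return (.fail, ⟨#[]⟩, ⟨#[]⟩)
    | some (s, _, x0) =>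
      if s > 1e-7 then return (.infeasible, ⟨#[]⟩, ⟨#[]⟩)
      -- shift the origin to the feasible point x0
      let mut bs : FloatArray := ⟨Array.replicate m 0.0⟩
      for i in [0:m] do
        let mut v := b.get! i
        for j in [0:n] do
          v := v - A.get i j * x0.get! j
        bs := bs.set! i v
      let (st, d, y) := solveFreeNonneg c A bs
      match st with
      | .opt => return (.opt, ⟨(Array.range n).map fun j => x0.get! j + d.get! j⟩, y)
      | s' => return (s', ⟨#[]⟩, ⟨#[]⟩)
  else
    return solveFreeNonneg c A b

/-! ### Smoke tests (compiled evaluation) -/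

/-- `max x+y s.t. x ≤ 1, y ≤ 2, x+y ≤ 2.5, x,y ≥ 0` has value `2.5` with duals `(0,0,1,0,0)`. [folklore] -/
def smokeA : FMat := Id.run do
  let rows : Array (Array Float) := #[#[1, 0], #[0, 1], #[1, 1], #[0.0 - 1.0, 0], #[0, 0.0 - 1.0]]
  let mut M := FMat.zeros 5 2
  for i in [0:5] do
    for j in [0:2] do
      M := M.set i j (rows[i]!)[j]!
  return M

/-- The smoke LP's result, as a Boolean claim checked by compiled evaluation. [folklore] -/
def smokeOK : Bool :=
  let (st, x, y) := solve ⟨#[1.0, 1.0]⟩ smokeA ⟨#[1.0, 2.0, 2.5, 0.0, 0.0]⟩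
  st == .opt && Float.abs (x.get! 0 + x.get! 1 - 2.5) < 1e-9 && Float.abs (y.get! 2 - 1.0) < 1e-9

/-- An infeasible system `x ≤ −1, −x ≤ −1` is detected with `s = 1`. [folklore] -/
def smokeInfeasibleOK : Bool :=
  let A : FMat := (FMat.zeros 2 1).set 0 0 1.0 |>.set 1 0 (0.0 - 1.0)
  match farkas A ⟨#[0.0 - 1.0, 0.0 - 1.0]⟩ with
  | some (s, y, _) => Float.abs (s - 1.0) < 1e-9 && Float.abs (y.get! 0 - 0.5) < 1e-9 && Float.abs (y.get! 1 - 0.5) < 1e-9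
  | none => false

end LP

end QuadCert

end Literature.Analysis.ValidatedNumerics
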